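import Literature.AlgebraicGeometry.ShimuraVarieties.BallQuotientHodgeClassesFromSpecialCycles
import Literature.AlgebraicGeometry.HodgeTheory.DivisorCupRaisesGeometricConiveau
import Literature.AlgebraicGeometry.HodgeTheory.LefschetzOneOneHolds
import HarnessLib

/-!
# Thm. 1 of Bergeron–Millson–Moeglin from Thm. 4 and Cor. 62 ONLY: the moving hypothesis and Lefschetz `(1,1)` discharged

Family `hodge`, layer `Literature/AlgebraicGeometry/ShimuraVarieties`. THEOREMS ONLY (no definition,
no named fact; D-0026). Sequel of `BallQuotientHodgeClassesFromSpecialCycles`, whose reduction of the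
named fact `bmm2016_generalizedHodge_lowDegree` (Thm. 1 of N. Bergeron, J. Millson, C. Moeglin, *The
Hodge conjecture and arithmetic quotients of complex balls*, Acta Math. 216 (2016), in the range
`2n − c < p + 1`) to Thm. 4 of that paper (`mem_supportedClasses_of_hodgeConiveau_of_thm4`,
`bmm2016_generalizedHodge_lowDegree_of_thm4`: "Theorem 1 then immediately follows from Theorem 4 and
Lefschetz' `(1,1)` Theorem", §1.7 Remark 2) carries two further binders:

* `hmove` — Chow's moving lemma for divisors in cohomological form (classes of `H²` dying off a
  divisor `Z` are sums of classes dying off divisors `T` meeting a given closed `W` properly), used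
  only through the level calculus `N¹ H² ∪ Nʳ Hʲ ⊆ Nʳ⁺¹ Hʲ⁺²`
  (`cupProduct_mem_supportedClasses_succ_of_divisor_left/right`);
* `hL : lefschetzOneOne_rational` — Lefschetz's theorem on `(1,1)`-classes.

Both are now THEOREMS of the tree: the level calculus holds on every smooth projective complex
variety WITHOUT moving (`HodgeTheory.cupProduct_mem_supportedClasses_succ_of_mem_algebraicClasses_one`
and `…_right`, file `DivisorCupRaisesGeometricConiveau`: Deligne's Gysin description of `Nᶜ`, Hodge
III Cor. 8.2.8, the projection formula, and Lefschetz `(1,1)` on the resolved supports), and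
`lefschetzOneOne_rational_holds`. This file re-runs the printed induction (§1.2–1.7) with those two
inputs supplied, so that **the named fact is reduced to exactly BMM's Thm. 4 (`h4`, in Hodge-model
form) and Cor. 62 (`bmm2016_hodgePQ_definedOverQ`)** — the two automorphic inputs (Kudla–Millson
theory, the theta correspondence, Arthur's classification), nothing else.

* `cupProduct_specialCycleClasses_mem_supportedClasses_succ` — `SC^{2a'}(S) ⊗ ℂ ∪ N¹ H² ⊆ N^{a'+1}`,
  no moving hypothesis;
* `mem_supportedClasses_of_hodgeConiveau_of_thm4_of_cor62` — Thm. 1 on one ball quotient from Thm. 4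
  (binders `hoff`, `hdiag`, verbatim those of `mem_supportedClasses_of_hodgeConiveau_of_thm4`) and
  Cor. 62, for a divisor-supported `κ`;
* `bmm2016_generalizedHodge_lowDegree_of_thm4_of_cor62` — the named fact from `h4` and Cor. 62.

## References

* [BergeronMillsonMoeglin2016Balls] N. Bergeron, J. Millson, C. Moeglin, The Hodge conjecture and
  arithmetic quotients of complex balls, Acta Math. 216 (2016) (arXiv:1306.1515v2): §1.2 Thm. 1 and
  Remark 3, §1.6, §1.7 Thm. 4 and Remark 2.
* [Fulton1998] W. Fulton, Intersection Theory, 2nd ed. (1998), §19.2 (cup product with supports).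
* [DeligneHodgeIII1974] P. Deligne, Théorie de Hodge III, Publ. Math. IHÉS 44 (1974), Cor. 8.2.8.
* [VoisinHodgeI2002] C. Voisin, Hodge Theory and Complex Algebraic Geometry I (2002), Thm. 6.25,
  Rem. 6.27, Thm. 11.30.
* [Voisin2025] C. Voisin, Hodge and generalized Hodge conjectures, coniveau and algebraic cycles,
  J. Open Math. Probl. 1 (2025), §4.3 (first paragraph).
-/

noncomputable section

open CategoryTheory

namespace Literature.AlgebraicGeometry.ShimuraVarieties

open Literature.AlgebraicGeometry.Motives (SchemeOver IsSmoothProjective)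
open Literature.AlgebraicGeometry.HodgeTheory
open Literature.AlgebraicTopology.SingularHomology

variable {p : ℕ} {X : SchemeOver ℂ}

section SpecialCycles

variable (D : UnitaryBallQuotientDatum p X)

/-- **Special cycles times divisor classes, with no moving hypothesis**: for `s ∈ SC^{2a'}(S) ⊗ ℂ`
and `κ ∈ N¹ H²(X(ℂ); ℂ)`, `s ∪ κ ∈ N^{a'+1} H^{2a'+2}(X(ℂ); ℂ)` (special cycle classes are supported in
codimension `a'`, `specialCycleClasses_le_supportedClasses`, and `Nᶜ ∪ N¹ H² ⊆ Nᶜ⁺¹` on the smooth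
projective `X`, `cupProduct_mem_supportedClasses_succ_of_mem_algebraicClasses_one_right`) — BMM's "cup
products of `(1,1)` classes and [special cycle classes]". [cite: BergeronMillsonMoeglin2016Balls, §1.2 Remark 3]
[cite: Fulton1998, §19.2 Cor. 19.2] [cite: DeligneHodgeIII1974, Cor. 8.2.8] -/
theorem cupProduct_specialCycleClasses_mem_supportedClasses_succ {a' n : ℕ} (h : 2 * a' + 2 = n)
    {s : complexBetti X (2 * a')} (hs : s ∈ specialCycleClasses D a') {κ : complexBetti X 2}
    (hκ : κ ∈ supportedClasses X 2 1) :
    cupProduct h s κ ∈ supportedClasses X n (a' + 1) :=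
  cupProduct_mem_supportedClasses_succ_of_mem_algebraicClasses_one_right D.isSmoothProjective h
    (specialCycleClasses_le_supportedClasses D a' hs) hκ

/-! ### Thm. 1 (low range) from Thm. 4 and Cor. 62: the induction on the level, no further input -/

/-- **Thm. 1 of BMM in the range `2n − c < p + 1`, on one ball quotient, from Thm. 4 (Hodge-model
form) and Cor. 62 alone.** Same statement and same proof as
`mem_supportedClasses_of_hodgeConiveau_of_thm4` (BMM §1.2–1.7: induction on the level `c`; off the
diagonal the special-cycle term lies in `N^{min(a,b)}`, on the diagonal the `(1,1)`-classes are
divisor classes by Cor. 62's Remark and Lefschetz `(1,1)`, and `κ ∪ y₀ ∈ N^{c'+1}` for `y₀ ∈ N^{c'}`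
by induction), with the two non-automorphic binders of that theorem DISCHARGED: the moving of
divisors (`hmove`) by `HodgeTheory.cupProduct_mem_supportedClasses_succ_of_mem_algebraicClasses_one`
(level calculus without moving, via Deligne's Gysin description of `Nᶜ`) and Lefschetz `(1,1)` by
`lefschetzOneOne_rational_holds`. Hypotheses left: Cor. 62 (`h62`), a divisor-supported class `κ`
(the Kähler class of the invariant metric) and Thm. 4 in the two printed shapes `hoff` (`a ≠ b`) and
`hdiag` (`a = b`). Nothing automorphic is proved here.
[cite: BergeronMillsonMoeglin2016Balls, §1.2 Thm. 1 and Remark 3, §1.6, §1.7 Thm. 4 and Remark 2]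
[cite: Fulton1998, §19.2] [cite: VoisinHodgeI2002, Thm. 6.25, Rem. 6.27 and Thm. 11.30] -/
theorem mem_supportedClasses_of_hodgeConiveau_of_thm4_of_cor62 (h62 : bmm2016_hodgePQ_definedOverQ)
    (A : HodgeModel p X) {κ : complexBetti X 2} (hκ : κ ∈ supportedClasses X 2 1)
    (hoff : ∀ (m' d n n₀ : ℕ) (h₁ : 2 * (m' + 1) + d = n) (h₂ : 2 + n₀ = n), 0 < d →
      3 * n + d < 2 * (p + 1) →
        ∀ x : complexBetti X n,
          A.pullback n x ∈
              A.hodgePQ n (m' + 1 + d) (m' + 1) ⊔ A.hodgePQ n (m' + 1) (m' + 1 + d) →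
            ∃ u ∈ Submodule.span ℂ {z : complexBetti X n |
                ∃ s ∈ specialCycleClasses D (m' + 1), ∃ y : complexBetti X d,
                  A.pullback d y ∈ A.hodgePQ d d 0 ⊔ A.hodgePQ d 0 d ∧ z = cupProduct h₁ s y},
              ∃ y₀ : complexBetti X n₀,
                A.pullback n₀ y₀ ∈ A.hodgePQ n₀ (m' + d) m' ⊔ A.hodgePQ n₀ m' (m' + d) ∧
                  x = u + cupProduct h₂ κ y₀)
    (hdiag : ∀ (a' n n₀ : ℕ) (h₁ : 2 * a' + 2 = n) (h₂ : 2 + n₀ = n), 3 * n < 2 * (p + 1) →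
      ∀ x : complexBetti X n, A.pullback n x ∈ A.hodgePQ n (a' + 1) (a' + 1) →
        ∃ u ∈ Submodule.span ℂ {z : complexBetti X n |
            ∃ s ∈ specialCycleClasses D a', ∃ y : complexBetti X 2,
              A.pullback 2 y ∈ A.hodgePQ 2 1 1 ∧ z = cupProduct h₁ s y},
          ∃ y₀ : complexBetti X n₀, A.pullback n₀ y₀ ∈ A.hodgePQ n₀ a' a' ∧
            x = u + cupProduct h₂ κ y₀) :
    ∀ (c n : ℕ), 2 * n < p + 1 + c →
      ∀ x : complexBetti X n, A.pullback n x ∈ A.hodgeConiveau n c → x ∈ supportedClasses X n c := by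
  have hX : IsSmoothProjective p X := D.isSmoothProjective
  intro c
  induction c with
  | zero =>
    intro n _ x _
    rw [supportedClasses_zero]
    exact Submodule.mem_top
  | succ c' ih =>
    intro n hnc
    -- the off-diagonal pieces `H^{m'+1+d, m'+1} ⊕ H^{m'+1, m'+1+d}`, `m' ≥ c'`, `d > 0`
    have hoffN : ∀ (m' d : ℕ), c' ≤ m' → 0 < d → ∀ (h₁ : 2 * (m' + 1) + d = n)
        (x : complexBetti X n),
        A.pullback n x ∈ A.hodgePQ n (m' + 1 + d) (m' + 1) ⊔ A.hodgePQ n (m' + 1) (m' + 1 + d) →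
          x ∈ supportedClasses X n (c' + 1) := by
      intro m' d hcm hd h₁ x hx
      have h₂ : 2 + (2 * m' + d) = n := by omega
      obtain ⟨u, hu, y₀, hy₀, rfl⟩ := hoff m' d n (2 * m' + d) h₁ h₂ hd (by omega) x hx
      refine Submodule.add_mem _ ?_ ?_
      · -- `u ∈ N^{m'+1} ⊆ N^{c'+1}`: special cycles of codimension `m' + 1` times anything
        exact supportedClasses_mono X n (by omega : c' + 1 ≤ m' + 1)
          (span_cupProduct_specialCycleClasses_le_supportedClasses D h₁ _ hu)
      · -- `κ ∪ y₀ ∈ N^{c'+1}`: `y₀ ∈ N^{c'} H^{n-2}` by induction, then the level calculus (no moving)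
        have hy₀N : y₀ ∈ supportedClasses X (2 * m' + d) c' :=
          ih (2 * m' + d) (by omega) y₀
            (sup_le (A.hodgePQ_le_hodgeConiveau (by omega) (by omega) (by omega))
              (A.hodgePQ_le_hodgeConiveau (by omega) (by omega) (by omega)) hy₀)
        exact cupProduct_mem_supportedClasses_succ_of_mem_algebraicClasses_one hX hκ h₂ hy₀N
    -- the diagonal pieces `H^{a'+1, a'+1}`, `a' ≥ c'`
    have hdiagN : ∀ (a' : ℕ), c' ≤ a' → ∀ (h₁ : 2 * a' + 2 = n) (x : complexBetti X n),
        A.pullback n x ∈ A.hodgePQ n (a' + 1) (a' + 1) → x ∈ supportedClasses X n (c' + 1) := by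
      intro a' hca h₁ x hx
      have h₂ : 2 + 2 * a' = n := by omega
      have hp2 : 2 < p := by omega
      obtain ⟨u, hu, y₀, hy₀, rfl⟩ := hdiag a' n (2 * a') h₁ h₂ (by omega) x hx
      refine Submodule.add_mem _ ?_ ?_
      · -- `u ∈ N^{a'} ∪ N¹ ⊆ N^{a'+1} ⊆ N^{c'+1}`: `(1,1)`-classes are divisor classes (Cor. 62 +
        -- Lefschetz `(1,1)`), and the level calculus (no moving)
        refine supportedClasses_mono X n (by omega : c' + 1 ≤ a' + 1) ?_
        refine (Submodule.span_le.2 ?_) hu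
        rintro z ⟨s, hs, y, hy, rfl⟩
        exact cupProduct_specialCycleClasses_mem_supportedClasses_succ D h₁ hs
          (mem_supportedClasses_of_hodgeOneOne h62 lefschetzOneOne_rational_holds ⟨D⟩ hX hp2 A y hy)
      · -- `κ ∪ y₀ ∈ N^{c'+1}`: `y₀ ∈ H^{a',a'}` has Hodge coniveau `≥ c'`, induction, level calculus
        have hy₀N : y₀ ∈ supportedClasses X (2 * a') c' :=
          ih (2 * a') (by omega) y₀ (A.hodgePQ_le_hodgeConiveau (by omega) hca hca hy₀)
        exact cupProduct_mem_supportedClasses_succ_of_mem_algebraicClasses_one hX hκ h₂ hy₀N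
    -- assemble: every piece `H^{a,b}`, `a + b = n`, `a, b ≥ c' + 1`, lies in the image of `N^{c'+1}`
    intro x hx
    suffices hle : A.hodgeConiveau n (c' + 1) ≤ (supportedClasses X n (c' + 1)).map (A.pullback n).hom by
      obtain ⟨x', hx', hxx'⟩ := hle hx
      obtain rfl : x' = x := A.pullback_injective n hxx'
      exact hx'
    refine iSup_le fun a ↦ iSup_le fun b ↦ iSup_le fun hab ↦ iSup_le fun ha ↦ iSup_le fun hb ↦ ?_
    intro z hz
    obtain ⟨x, rfl⟩ := A.pullback_surjective n z
    refine ⟨x, ?_, rfl⟩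
    rcases Nat.lt_trichotomy a b with hlt | heq | hgt
    · -- `a < b`: `(a, b) = (m' + 1, m' + 1 + d)`
      obtain ⟨m', rfl⟩ : ∃ m', a = m' + 1 := ⟨a - 1, by omega⟩
      obtain ⟨d, rfl⟩ : ∃ d, b = m' + 1 + d := ⟨b - (m' + 1), by omega⟩
      exact hoffN m' d (by omega) (by omega) (by omega) x (Submodule.mem_sup_right hz)
    · -- `a = b = a' + 1`
      subst heq
      obtain ⟨a', rfl⟩ : ∃ a', a = a' + 1 := ⟨a - 1, by omega⟩
      exact hdiagN a' (by omega) (by omega) x hz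
    · -- `a > b`: `(a, b) = (m' + 1 + d, m' + 1)`
      obtain ⟨m', rfl⟩ : ∃ m', b = m' + 1 := ⟨b - 1, by omega⟩
      obtain ⟨d, rfl⟩ : ∃ d, a = m' + 1 + d := ⟨a - (m' + 1), by omega⟩
      exact hoffN m' d (by omega) (by omega) (by omega) x (Submodule.mem_sup_left hz)

end SpecialCycles

/-! ### The named fact from Thm. 4 and Cor. 62 -/

/-- **The named fact `bmm2016_generalizedHodge_lowDegree` (BMM Thm. 1, range `2n − c < p + 1`)
follows from Thm. 4 (Hodge-model form, `h4`, as in `bmm2016_generalizedHodge_lowDegree_of_thm4`) and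
Cor. 62 (`bmm2016_hodgePQ_definedOverQ`) ALONE** — the moving of divisors and Lefschetz `(1,1)`,
binders of `bmm2016_generalizedHodge_lowDegree_of_thm4`, being theorems of the tree. "Theorem 1 then
immediately follows from Theorem 4 and Lefschetz' `(1,1)` Theorem."
[cite: BergeronMillsonMoeglin2016Balls, §1.2 Thm. 1, §1.7 Thm. 4 and Remark 2]
[cite: VoisinHodgeI2002, Thm. 11.30] [cite: DeligneHodgeIII1974, Cor. 8.2.8] -/
theorem bmm2016_generalizedHodge_lowDegree_of_thm4_of_cor62 (h62 : bmm2016_hodgePQ_definedOverQ)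
    (h4 : ∀ ⦃p : ℕ⦄ ⦃X : SchemeOver ℂ⦄ (D : UnitaryBallQuotientDatum p X) (A : HodgeModel p X),
      ∃ κ ∈ supportedClasses X 2 1,
        (∀ (m' d n n₀ : ℕ) (h₁ : 2 * (m' + 1) + d = n) (h₂ : 2 + n₀ = n), 0 < d →
          3 * n + d < 2 * (p + 1) →
            ∀ x : complexBetti X n,
              A.pullback n x ∈
                  A.hodgePQ n (m' + 1 + d) (m' + 1) ⊔ A.hodgePQ n (m' + 1) (m' + 1 + d) →
                ∃ u ∈ Submodule.span ℂ {z : complexBetti X n |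
                    ∃ s ∈ specialCycleClasses D (m' + 1), ∃ y : complexBetti X d,
                      A.pullback d y ∈ A.hodgePQ d d 0 ⊔ A.hodgePQ d 0 d ∧ z = cupProduct h₁ s y},
                  ∃ y₀ : complexBetti X n₀,
                    A.pullback n₀ y₀ ∈ A.hodgePQ n₀ (m' + d) m' ⊔ A.hodgePQ n₀ m' (m' + d) ∧
                      x = u + cupProduct h₂ κ y₀) ∧
        (∀ (a' n n₀ : ℕ) (h₁ : 2 * a' + 2 = n) (h₂ : 2 + n₀ = n), 3 * n < 2 * (p + 1) →
          ∀ x : complexBetti X n, A.pullback n x ∈ A.hodgePQ n (a' + 1) (a' + 1) →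
            ∃ u ∈ Submodule.span ℂ {z : complexBetti X n |
                ∃ s ∈ specialCycleClasses D a', ∃ y : complexBetti X 2,
                  A.pullback 2 y ∈ A.hodgePQ 2 1 1 ∧ z = cupProduct h₁ s y},
              ∃ y₀ : complexBetti X n₀, A.pullback n₀ y₀ ∈ A.hodgePQ n₀ a' a' ∧
                x = u + cupProduct h₂ κ y₀)) :
    bmm2016_generalizedHodge_lowDegree := by
  intro p X hD _ n c hnc x _ hA
  obtain ⟨A, hxA⟩ := hA
  obtain ⟨D⟩ := hD
  obtain ⟨κ, hκ, hoff, hdiag⟩ := h4 D A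
  exact mem_supportedClasses_of_hodgeConiveau_of_thm4_of_cor62 D h62 A hκ hoff hdiag c n hnc x hxA

end Literature.AlgebraicGeometry.ShimuraVarieties

end
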